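import Mathlib

/-!
# Route BarrierLever — binary codes of set families (tool for the finite TT rungs; item 19152 / 19930)

`--supports stmt-ValiantsHypothesis-19930`; cell valiant-natproofs, rung V4, prover gen 9 (memo
`HOME/prover/gen9/HUB-MEMO-g9.md` §5). A family of subsets of `Fin h` is encoded as a natural number
(`famCode`: bit `code s` is set iff `s` is a member, `code s = ∑_{a ∈ s} 2^a`), with `testBit_code`, `code_lt`,
`code_injective`, `testBit_famCode`, `famCode_lt`, `famCode_injective`, `code_erase`, and `isDownMask_famCode`: a
family closed under `s ↦ s.erase a` (e.g. the image of a layout whose range is a lower set,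
`isDownMask_famCode_image`) has a code passing the `Bool` bit test `isDownMask`.

PURPOSE and a measured caveat. The ∀-form of the finite rung «TT(h = 4, ∀ r)» needs «every down-closed family of
subsets of `Fin 4` is one of 168 explicit ones». Kernel enumeration is NOT a route to it: `decide` over
`Finset (Finset (Fin 4))` (1820-element probe) exceeds 900 s, and even the numeral form
`∀ hi < 256, ∀ lo < 256, isDownMask 4 (256·hi+lo) → … ∈ maskList` ends in «(kernel) excessive memory
consumption» after 844 s. What remains viable is a STRUCTURAL enumeration (down-sets of `2^[n+1]` = pairs `B ⊆ A`
of down-sets of `2^[n]`, a 168-element list for `n = 4`) whose per-element table lookups are then keyed by the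
numeric `famCode` of this file (fast `Nat` equality instead of `Finset (Finset _)` equality).

WHAT THIS IS NOT: bookkeeping only; nothing on TT, crux stmt-ValiantsHypothesis-14610, or `VP` versus `VNP`.
-/

-- layout Summits/ValiantsHypothesis/ValiantsHypothesis forces the duplicated namespace component
set_option linter.dupNamespace false

namespace Summit.ValiantsHypothesis.ValiantsHypothesis.Theorems.BarrierLever.FamilyCode

open Finset

variable {h : ℕ}

/-- Binary code of a subset of `Fin h`: `∑_{a ∈ s} 2^a`. -/
def code (s : Finset (Fin h)) : ℕ := ∑ i ∈ s.map Fin.valEmbedding, 2 ^ i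

/-- Binary code of a family of subsets of `Fin h`: bit `code s` is set iff `s ∈ U`. -/
def famCode (U : Finset (Finset (Fin h))) : ℕ := ∑ v ∈ U.image code, 2 ^ v

/-- The bit test «down-closed» (a `Bool`, fast on numerals): whenever bit `v < 2^h` of `m` is set and bit
`a < h` of `v` is set, bit `v - 2^a` of `m` is set. -/
def isDownMask (h m : ℕ) : Bool :=
  decide (∀ v < 2 ^ h, Nat.testBit m v = true → ∀ a < h, Nat.testBit v a = true →
    Nat.testBit m (v - 2 ^ a) = true)

/-- Bits of a sum of distinct powers of two. -/
theorem testBit_sum_two_pow (s : Finset ℕ) (b : ℕ) : (∑ i ∈ s, 2 ^ i).testBit b = true ↔ b ∈ s := by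
  rw [← Nat.mem_bitIndices, ← List.mem_toFinset, Finset.toFinset_bitIndices_sum_two_pow]

/-- Bit `b` of `code s` is set iff `b` is (the value of) a member of `s`. -/
theorem testBit_code (s : Finset (Fin h)) (b : ℕ) : (code s).testBit b = true ↔ ∃ a ∈ s, (a : ℕ) = b := by
  rw [code, testBit_sum_two_pow, Finset.mem_map]
  simp only [Fin.valEmbedding_apply]

/-- Membership form of `testBit_code`. -/
theorem testBit_code_val (s : Finset (Fin h)) (a : Fin h) : (code s).testBit a = true ↔ a ∈ s := by
  rw [testBit_code]
  constructor
  · rintro ⟨a', ha', he⟩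
    rwa [← Fin.ext he]
  · intro ha
    exact ⟨a, ha, rfl⟩

/-- Codes of subsets of `Fin h` are `< 2^h`. -/
theorem code_lt (s : Finset (Fin h)) : code s < 2 ^ h := by
  apply Nat.lt_pow_two_of_testBit
  intro i hi
  cases hb : (code s).testBit i with
  | false => rfl
  | true =>
    obtain ⟨a, -, ha⟩ := (testBit_code s i).mp hb
    omega

/-- `code` is injective. -/
theorem code_injective : Function.Injective (code (h := h)) := by
  intro s t hst
  ext a
  rw [← testBit_code_val, ← testBit_code_val, hst]

/-- Bit `v` of `famCode U` is set iff `v` is the code of a member of `U`. -/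
theorem testBit_famCode (U : Finset (Finset (Fin h))) (v : ℕ) :
    (famCode U).testBit v = true ↔ ∃ s ∈ U, code s = v := by
  rw [famCode, testBit_sum_two_pow, Finset.mem_image]

/-- Family codes are `< 2^(2^h)`. -/
theorem famCode_lt (U : Finset (Finset (Fin h))) : famCode U < 2 ^ (2 ^ h) := by
  apply Nat.lt_pow_two_of_testBit
  intro i hi
  cases hb : (famCode U).testBit i with
  | false => rfl
  | true =>
    obtain ⟨s, -, hs⟩ := (testBit_famCode U i).mp hb
    have := code_lt s
    omega

/-- Membership in a family is a bit of its code. -/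
theorem mem_iff_testBit_famCode (U : Finset (Finset (Fin h))) (s : Finset (Fin h)) :
    s ∈ U ↔ (famCode U).testBit (code s) = true := by
  rw [testBit_famCode]
  constructor
  · intro hs
    exact ⟨s, hs, rfl⟩
  · rintro ⟨t, ht, hts⟩
    rwa [← code_injective hts]

/-- `famCode` is injective. -/
theorem famCode_injective : Function.Injective (famCode (h := h)) := by
  intro U V hUV
  ext s
  rw [mem_iff_testBit_famCode, mem_iff_testBit_famCode, hUV]

/-- Erasing a member subtracts its power of two from the code. -/
theorem code_erase (s : Finset (Fin h)) (a : Fin h) (ha : a ∈ s) :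
    code (s.erase a) = code s - 2 ^ (a : ℕ) := by
  have hsum : code s = 2 ^ (a : ℕ) + code (s.erase a) := by
    unfold code
    rw [Finset.map_erase]
    exact (Finset.add_sum_erase _ (fun i => 2 ^ i) (Finset.mem_map_of_mem _ ha)).symm
  omega

/-- **Down-closed families have down-closed codes.** If `U` is closed under `s ↦ s.erase a` (`a ∈ s`),
then `famCode U` passes the bit test `isDownMask h`. -/
theorem isDownMask_famCode (U : Finset (Finset (Fin h))) (hU : ∀ s ∈ U, ∀ a ∈ s, s.erase a ∈ U) :
    isDownMask h (famCode U) = true := by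
  rw [isDownMask, decide_eq_true_iff]
  intro v _ hbit a ha habit
  obtain ⟨s, hs, rfl⟩ := (testBit_famCode U v).mp hbit
  have ha' : (⟨a, ha⟩ : Fin h) ∈ s := (testBit_code_val s ⟨a, ha⟩).mp habit
  rw [← code_erase s ⟨a, ha⟩ ha']
  exact (testBit_famCode U _).mpr ⟨_, hU s hs _ ha', rfl⟩

/-- The image of an injective layout whose range is a lower set is closed under erasing members. -/
theorem erase_mem_image_of_isLowerSet {r : ℕ} (u : Fin r → Finset (Fin h))
    (hl : IsLowerSet (Set.range u)) :
    ∀ s ∈ Finset.univ.image u, ∀ a ∈ s, s.erase a ∈ Finset.univ.image u := by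
  intro s hs a _
  obtain ⟨i, -, rfl⟩ := Finset.mem_image.mp hs
  obtain ⟨j, hj⟩ : (u i).erase a ∈ Set.range u := hl (Finset.erase_subset a (u i)) ⟨i, rfl⟩
  exact Finset.mem_image.mpr ⟨j, Finset.mem_univ _, hj⟩

/-- Hence the code of the image of such a layout is a down-closed mask. -/
theorem isDownMask_famCode_image {r : ℕ} (u : Fin r → Finset (Fin h)) (hl : IsLowerSet (Set.range u)) :
    isDownMask h (famCode (Finset.univ.image u)) = true :=
  isDownMask_famCode _ (erase_mem_image_of_isLowerSet u hl)

/-- The code of the image of an injective layout of size `r` has exactly... at least: its members are the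
codes of the `u i`; recorded as the two inclusions used downstream. -/
theorem testBit_famCode_image {r : ℕ} (u : Fin r → Finset (Fin h)) (v : ℕ) :
    (famCode (Finset.univ.image u)).testBit v = true ↔ ∃ i, code (u i) = v := by
  rw [testBit_famCode]
  constructor
  · rintro ⟨s, hs, rfl⟩
    obtain ⟨i, -, rfl⟩ := Finset.mem_image.mp hs
    exact ⟨i, rfl⟩
  · rintro ⟨i, rfl⟩
    exact ⟨u i, Finset.mem_image.mpr ⟨i, Finset.mem_univ _, rfl⟩, rfl⟩

end Summit.ValiantsHypothesis.ValiantsHypothesis.Theorems.BarrierLever.FamilyCode
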